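import Summits.PneNP.PneNP.Theses.NoTardosTropics
import Literature.Computability.Complexity.FKPointLocationTreeLocate
import Literature.Combinatorics.Optimization.DifferenceConstraints

/-!
# Route NoTardosTropics, support item `MadHNonuniform`: the non-uniform upper bound

Closes `Summit.PneNP.PneNP.Theses.NoTardosTropics.MadHNonuniform` (item stmt-PneNP-2570): for a
polynomial `q`, every slice `MPG_ℝ(n) ⊆ ℝⁿ` of the real mean-payoff language of the route is decided
by a sign-query oracle algorithm with an ARBITRARY step function (a linear decision tree) within
`q(n)` rounds and with queries of length `≤ q(n)`.

Proof. `MPG_ℝ(n)` is SIGN-DETERMINED at coefficient bound `n + 1 ≤ 2^{n+1}`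
(`mpgPred_iff_of_signAgree`): membership reads the input only through the bits `xᵢ = 1` (the sign of
the form `xᵢ - 1`) and through the feasibility of a system of difference constraints
`π v ≤ π u + w(u,v)` on a sub-digraph of the arena, which holds iff every closed walk with at most
`k` arcs has non-negative weight (Gallai / Bellman–Ford,
`Literature.Combinatorics.Optimization.DifferenceConstraints`), i.e. iff finitely many integer
forms with coefficients `≤ k + 1` (arc multiplicities) are non-negative. The non-uniform
point-location theorem of Meyer auf der Heide / Fournier–Koiran in the tree's rendering
(`Literature.Computability.Complexity.FKPointLocation.exists_poly_treeAlg_of_signDetermined`: the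
Fournier–Koiran location protocol run as a decision tree that answers its own `NP` questions) then
gives the algorithm, with `q = ((X+5)(X+3)³)^24`.

## References

* F. Meyer auf der Heide, J. ACM 31 (1984) 668–676; J. ACM 35 (1988) 740–747. [Meyeraufderheide1984]
  [MeyerAufDerHeide1988]
* H. Fournier, P. Koiran, ICALP 2000 = LIP RR-1999-21, §2. [FournierKoiran2000]
* T. H. Cormen, C. E. Leiserson, R. L. Rivest, C. Stein, *Introduction to Algorithms*, 3rd ed., 2009,
  Thm 24.9 (difference constraints and negative cycles). [CLRS2009]
-/

set_option linter.dupNamespace false -- `Summit.PneNP.PneNP.…`: summit = sub-problem name (D-0017 single-conjunct layout)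

namespace Summit.PneNP.PneNP.Theorems

open Literature.Computability.Complexity Literature.Computability.Complexity.FKPointLocation
open Literature.Combinatorics.Optimization Literature.Combinatorics.Optimization.DifferenceConstraints
open Finset

/-! The real mean-payoff predicate `x ∈ MPG_ℝ(n)` of the route is used VERBATIM (the body of the
`decide` in `MadHNonuniform`): `n = k + 2k²` read as `k` owner bits, `k²` arc indicators, `k²` weights;
arena total; a positional strategy `σ` of Max, a set `R ∋ 0` closed under `σ` at Max vertices and under
all arcs at Min vertices, and a potential `π` on those arcs. No abbreviation is introduced. -/

/-! ### Reading the input through bounded forms -/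

section Forms

variable {n : ℕ}

/-- The padded coordinate function `g m = (ofFn x).getD m 0` reads `x` below `n` and `0` above. [folklore] -/
theorem getD_ofFn_eq (x : Fin n → ℝ) (m : ℕ) :
    (List.ofFn x).getD m 0 = if h : m < n then x ⟨m, h⟩ else 0 := by
  split_ifs with h
  · exact getD_ofFn x ⟨m, h⟩ 0
  · rw [List.getD_eq_default]; simpa using not_lt.1 h

/-- `SignAgree` is symmetric. [folklore] -/
theorem signAgree_symm {Bd : ℕ} {x x' : Fin n → ℝ} (h : SignAgree Bd x x') : SignAgree Bd x' x :=
  fun a c ha hc => (h a c ha hc).symm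

/-- Sign-agreeing inputs have the same bits `xₘ = 1` (the form `xₘ - 1`, coefficients `≤ 1`). [folklore] -/
theorem getD_eq_one_iff_of_signAgree {Bd : ℕ} (hBd : 1 ≤ Bd) {x x' : Fin n → ℝ} (h : SignAgree Bd x x') (m : ℕ) :
    (List.ofFn x).getD m 0 = 1 ↔ (List.ofFn x').getD m 0 = 1 := by
  rw [getD_ofFn_eq, getD_ofFn_eq]
  split_ifs with hm
  · have key := h (Pi.single ⟨m, hm⟩ 1) (-1) (fun i => by
      rw [Pi.single_apply]; split_ifs <;> simp [hBd]) (by simpa using hBd)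
    simp only [Pi.single_apply, Int.cast_ite, Int.cast_one, Int.cast_zero, ite_mul, one_mul, zero_mul,
      sum_ite_eq', mem_univ, if_true, Int.cast_neg] at key
    constructor
    · intro h1
      rw [h1] at key
      have : SignType.sign ((-1 : ℝ) + x' ⟨m, hm⟩) = 0 := by rw [← key]; norm_num
      linarith [sign_eq_zero_iff.1 this]
    · intro h1
      rw [h1] at key
      have : SignType.sign ((-1 : ℝ) + x ⟨m, hm⟩) = 0 := by rw [key]; norm_num
      linarith [sign_eq_zero_iff.1 this]
  · simp

/-- Equal signs give equal non-negativity. [folklore] -/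
theorem nonneg_iff_of_sign_eq {u v : ℝ} (h : SignType.sign u = SignType.sign v) : 0 ≤ u ↔ 0 ≤ v := by
  rcases lt_trichotomy u 0 with hu | hu | hu
  · rw [sign_neg hu] at h
    have hv : v < 0 := sign_eq_neg_one_iff.1 h.symm
    exact ⟨fun h' => absurd hu (not_lt.2 h'), fun h' => absurd hv (not_lt.2 h')⟩
  · rw [hu, sign_zero] at h
    have hv : v = 0 := sign_eq_zero_iff.1 h.symm
    rw [hu, hv]
  · rw [sign_pos hu] at h
    have hv : 0 < v := sign_eq_one_iff.1 h.symm
    exact ⟨fun _ => hv.le, fun _ => hu.le⟩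

end Forms

/-! ### The arena read off the input, potentials and closed walks -/

section Arena

variable {n k : ℕ}

/-- The index of the weight of the arc `(u, v)`: `k + k² + (u k + v) < n` when `n = k + 2k²`. [folklore] -/
theorem weightIndex_lt (hn : n = k + 2 * k * k) (u v : Fin k) : k + k * k + (u.val * k + v.val) < n := by
  have hu := u.isLt
  have hv := v.isLt
  have h1 : (u.val + 1) * k ≤ k * k := Nat.mul_le_mul_right k hu
  rw [hn]
  nlinarith

/-- The weight function of the route's predicate is a coordinate weight `x (e u v)` for any arc
labelling `e` by the weight indices. [folklore] -/
theorem weight_fun_eq (x : Fin n → ℝ) (e : Fin k → Fin k → Fin n) (he : ∀ u v, (e u v).val = k + k * k + (u.val * k + v.val)) :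
    (fun u v : Fin k => (List.ofFn x).getD (k + k * k + (u.val * k + v.val)) 0) = fun u v => x (e u v) := by
  funext u v
  rw [getD_ofFn_eq, dif_pos (by rw [← he]; exact (e u v).isLt)]
  congr 1
  exact Fin.ext (he u v).symm

/-- **Transfer of short non-negative closed walks** between sign-agreeing inputs: the weight of a
walk with at most `k + 1` vertices for coordinate weights is an integer form with coefficients
`≤ k + 1 ≤ Bd` (arc multiplicities). [folklore] -/
theorem weight_nonneg_transfer {Bd : ℕ} {x x' : Fin n → ℝ} (h : SignAgree Bd x x') (hBd : k + 1 ≤ Bd)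
    (e : Fin k → Fin k → Fin n) {l : List (Fin k)} (hl : l.length ≤ k + 1)
    (hw : 0 ≤ weight (fun u v => x (e u v)) l) : 0 ≤ weight (fun u v => x' (e u v)) l := by
  classical
  rw [weight_eq_sum_mult] at hw ⊢
  have key := h (fun i => (mult e l i : ℤ)) 0
    (fun i => by rw [Int.natAbs_natCast]; exact (mult_le_length _ l i).trans (hl.trans hBd)) (by simp)
  simp only [Int.cast_zero, zero_add, Int.cast_natCast] at key
  exact (nonneg_iff_of_sign_eq key).1 hw

end Arena

/-! ### Sign-determinacy of the predicate -/

section Determined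

variable {n : ℕ}

/-- **`MPG_ℝ(n)` is sign-determined**: one direction, at any bound `Bd ≥ n + 1`. [folklore] -/
theorem mpgPred_of_signAgree {Bd : ℕ} (hBd : n + 1 ≤ Bd) {x x' : Fin n → ℝ} (h : SignAgree Bd x x')
    (hx : (let g : ℕ → ℝ := fun m => (List.ofFn x).getD m 0
      ∃ k : ℕ, 0 < k ∧ n = k + 2 * k * k ∧ ((∀ u : Fin k, ∃ u' : Fin k, g (k + (u.val * k + u'.val)) = 1) ∧
        ∃ (σ : Fin k → Fin k) (R : Set (Fin k)) (π : Fin k → ℝ), (∃ v ∈ R, v.val = 0) ∧ ∀ u ∈ R,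
          (g u.val = 1 → g (k + (u.val * k + (σ u).val)) = 1 ∧ σ u ∈ R ∧
            π (σ u) ≤ π u + g (k + k * k + (u.val * k + (σ u).val))) ∧
          (g u.val ≠ 1 → ∀ u' : Fin k, g (k + (u.val * k + u'.val)) = 1 →
            u' ∈ R ∧ π u' ≤ π u + g (k + k * k + (u.val * k + u'.val)))))) :
    (let g : ℕ → ℝ := fun m => (List.ofFn x').getD m 0
      ∃ k : ℕ, 0 < k ∧ n = k + 2 * k * k ∧ ((∀ u : Fin k, ∃ u' : Fin k, g (k + (u.val * k + u'.val)) = 1) ∧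
        ∃ (σ : Fin k → Fin k) (R : Set (Fin k)) (π : Fin k → ℝ), (∃ v ∈ R, v.val = 0) ∧ ∀ u ∈ R,
          (g u.val = 1 → g (k + (u.val * k + (σ u).val)) = 1 ∧ σ u ∈ R ∧
            π (σ u) ≤ π u + g (k + k * k + (u.val * k + (σ u).val))) ∧
          (g u.val ≠ 1 → ∀ u' : Fin k, g (k + (u.val * k + u'.val)) = 1 →
            u' ∈ R ∧ π u' ≤ π u + g (k + k * k + (u.val * k + u'.val))))) := by
  classical
  obtain ⟨k, hk, hn, htot, σ, R, π, hv0, hR⟩ := hx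
  -- the bits agree
  have hbit : ∀ m, (List.ofFn x).getD m 0 = 1 ↔ (List.ofFn x').getD m 0 = 1 :=
    getD_eq_one_iff_of_signAgree (by omega) h
  have hkn : k + 1 ≤ Bd := by nlinarith
  -- the arc labelling by weight coordinates
  let e : Fin k → Fin k → Fin n := fun u v => ⟨k + k * k + (u.val * k + v.val), weightIndex_lt hn u v⟩
  have he : ∀ u v, (e u v).val = k + k * k + (u.val * k + v.val) := fun _ _ => rfl
  -- the sub-digraph of the arena used by the predicate (the same for `x` and `x'`)
  let E : Fin k → Fin k → Prop := fun u v =>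
    u ∈ R ∧ (((List.ofFn x).getD u.val 0 = 1 ∧ v = σ u) ∨
      ((List.ofFn x).getD u.val 0 ≠ 1 ∧ (List.ofFn x).getD (k + (u.val * k + v.val)) 0 = 1))
  -- `π` is a potential for the `x`-weights
  have hπ : IsPotential E (fun u v => x (e u v)) π := by
    intro u v huv
    rw [← weight_fun_eq x e he]
    rcases huv with ⟨huR, ⟨hgu, rfl⟩ | ⟨hgu, hge⟩⟩
    · exact ((hR u huR).1 hgu).2.2
    · exact ((hR u huR).2 hgu v hge).2
  -- hence a potential for the `x'`-weights
  obtain ⟨π', hπ'⟩ : ∃ π' : Fin k → ℝ, IsPotential E (fun u v => x' (e u v)) π' := by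
    refine exists_isPotential fun l hl hlen => ?_
    refine weight_nonneg_transfer h hkn e (by simpa using hlen) ?_
    exact weight_nonneg_of_isPotential hπ hl
  have hπ'' : ∀ u v, E u v → π' v ≤ π' u + (List.ofFn x').getD (k + k * k + (u.val * k + v.val)) 0 := by
    intro u v huv
    have := hπ' u v huv
    rw [← weight_fun_eq x' e he] at this
    exact this
  -- reassemble
  refine ⟨k, hk, hn, fun u => ?_, σ, R, π', hv0, fun u huR => ⟨fun hgu => ?_, fun hgu u' hge => ?_⟩⟩
  · obtain ⟨u', hu'⟩ := htot u
    exact ⟨u', (hbit _).1 hu'⟩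
  · have hgu1 : (List.ofFn x).getD u.val 0 = 1 := (hbit _).2 hgu
    obtain ⟨h1, h2, -⟩ := (hR u huR).1 hgu1
    exact ⟨(hbit _).1 h1, h2, hπ'' u (σ u) ⟨huR, Or.inl ⟨hgu1, rfl⟩⟩⟩
  · have hgu1 : (List.ofFn x).getD u.val 0 ≠ 1 := fun h1 => hgu ((hbit _).1 h1)
    have hge1 : (List.ofFn x).getD (k + (u.val * k + u'.val)) 0 = 1 := (hbit _).2 hge
    exact ⟨((hR u huR).2 hgu1 u' hge1).1, hπ'' u u' ⟨huR, Or.inr ⟨hgu1, hge1⟩⟩⟩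

/-- **`MPG_ℝ(n)` is sign-determined at bound `2^{n+1}`.** [folklore] -/
theorem mpgPred_iff_of_signAgree (n : ℕ) (x x' : Fin n → ℝ) (h : SignAgree (2 ^ (n + 1)) x x') :
    (let g : ℕ → ℝ := fun m => (List.ofFn x).getD m 0
      ∃ k : ℕ, 0 < k ∧ n = k + 2 * k * k ∧ ((∀ u : Fin k, ∃ u' : Fin k, g (k + (u.val * k + u'.val)) = 1) ∧
        ∃ (σ : Fin k → Fin k) (R : Set (Fin k)) (π : Fin k → ℝ), (∃ v ∈ R, v.val = 0) ∧ ∀ u ∈ R,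
          (g u.val = 1 → g (k + (u.val * k + (σ u).val)) = 1 ∧ σ u ∈ R ∧
            π (σ u) ≤ π u + g (k + k * k + (u.val * k + (σ u).val))) ∧
          (g u.val ≠ 1 → ∀ u' : Fin k, g (k + (u.val * k + u'.val)) = 1 →
            u' ∈ R ∧ π u' ≤ π u + g (k + k * k + (u.val * k + u'.val))))) ↔
    (let g : ℕ → ℝ := fun m => (List.ofFn x').getD m 0
      ∃ k : ℕ, 0 < k ∧ n = k + 2 * k * k ∧ ((∀ u : Fin k, ∃ u' : Fin k, g (k + (u.val * k + u'.val)) = 1) ∧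
        ∃ (σ : Fin k → Fin k) (R : Set (Fin k)) (π : Fin k → ℝ), (∃ v ∈ R, v.val = 0) ∧ ∀ u ∈ R,
          (g u.val = 1 → g (k + (u.val * k + (σ u).val)) = 1 ∧ σ u ∈ R ∧
            π (σ u) ≤ π u + g (k + k * k + (u.val * k + (σ u).val))) ∧
          (g u.val ≠ 1 → ∀ u' : Fin k, g (k + (u.val * k + u'.val)) = 1 →
            u' ∈ R ∧ π u' ≤ π u + g (k + k * k + (u.val * k + u'.val))))) :=
  have hBd : n + 1 ≤ 2 ^ (n + 1) := (Nat.lt_two_pow_self).le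
  ⟨mpgPred_of_signAgree hBd h, mpgPred_of_signAgree hBd (signAgree_symm h)⟩

end Determined

/-! ### The item -/

/-- **Item stmt-PneNP-2570 (`MadHNonuniform`), proved.** Non-uniformly, `MPG_ℝ` is decided by
polynomial-depth sign-query trees with polynomially short queries: the Fournier–Koiran location
protocol run as a decision tree (`exists_poly_treeAlg_of_signDetermined`) applied to the
route's predicate, which is sign-determined (`mpgPred_iff_of_signAgree`).
[cite: FournierKoiran2000, Thm 2 (report p. 4); after MeyerAufDerHeide1988 and FournierKoiran1998] -/
theorem madHNonuniform_proof : Summit.PneNP.PneNP.Theses.NoTardosTropics.MadHNonuniform := by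
  obtain ⟨q, hq⟩ := exists_poly_treeAlg_of_signDetermined
    (fun (n : ℕ) (x : Fin n → ℝ) => let g : ℕ → ℝ := fun m => (List.ofFn x).getD m 0
        ∃ k : ℕ, 0 < k ∧ n = k + 2 * k * k ∧ ((∀ u : Fin k, ∃ u' : Fin k, g (k + (u.val * k + u'.val)) = 1) ∧
          ∃ (σ : Fin k → Fin k) (R : Set (Fin k)) (π : Fin k → ℝ), (∃ v ∈ R, v.val = 0) ∧ ∀ u ∈ R,
            (g u.val = 1 → g (k + (u.val * k + (σ u).val)) = 1 ∧ σ u ∈ R ∧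
              π (σ u) ≤ π u + g (k + k * k + (u.val * k + (σ u).val))) ∧
            (g u.val ≠ 1 → ∀ u' : Fin k, g (k + (u.val * k + u'.val)) = 1 →
              u' ∈ R ∧ π u' ≤ π u + g (k + k * k + (u.val * k + u'.val)))))
    mpgPred_iff_of_signAgree
  refine ⟨q, fun n => ?_⟩
  obtain ⟨M, hM⟩ := hq n
  exact ⟨M, fun x => hM x⟩

end Summit.PneNP.PneNP.Theorems
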